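import Summits.ResolutionOfSingularities.ResolutionOfSingularities.Theorems.PurelyInseparableDim4IsolationCert
import Mathlib.RingTheory.Ideal.MinimalPrime.Noetherian
import Mathlib.RingTheory.Finiteness.Ideal
import HarnessLib

/-!
# [OURS · res-dim4-pi PR-10, part 6] The isolation certificate in RING FORM: for any Noetherian ring and
  maximal `𝔪`, «every minimal prime of `J` inside `𝔪` is `𝔪`» ⇔ `∃ N, 𝔪ᴺ ≤ J + 𝔪ᴺ⁺¹`; certificates are
  monotone in `N`

Cell `res-dim4-pi` (D-0157 DOOR 2), PR-10 sixth file (seat `res-dim4-p-3`, «N⁺ / F4-I line» of WAVE3 §S).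
COMPLEMENT to p-14's PR-12f `PurelyInseparableDim4IsolationConverse.lean` (p650409), which proves the
frame statements `IsolationConverse.exists_certificate_of_isIsolated` / `isIsolated_iff_exists_certificate`
(`IsIsolated q F ↔ J_q⁺(F) ≤ 𝔪₀ ∧ ∃ N, 𝔪₀ᴺ ≤ J_q⁺(F) ⊔ 𝔪₀ᴺ⁺¹`) by localising `K[x₁..x₄]` at `𝔪₀`; those
are CITED, not restated.  What this file adds:

* §1 (any commutative NOETHERIAN ring `A`, any ideal `J`, any MAXIMAL ideal `𝔪`)
  **`exists_pow_le_sup_pow_succ_of_minimalPrimes`**: if every minimal prime of `J` inside `𝔪` is `𝔪`, then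
  `∃ N, 𝔪ᴺ ≤ J + 𝔪ᴺ⁺¹` — a localisation-free proof: the finitely many minimal primes of `J` NOT inside `𝔪`
  (Mathlib `Ideal.finite_minimalPrimes_of_isNoetherianRing`) have a product `Q ⊄ 𝔪` (`Ideal.IsPrime.prod_le`);
  pick `s ∈ Q ∖ 𝔪`; then `s·𝔪 ≤ ⋂ (minimal primes) = √J` (`Ideal.sInf_minimalPrimes`), so
  `(s·𝔪)ᵏ = sᵏ·𝔪ᵏ ≤ J` for some `k` (`Ideal.exists_pow_le_of_le_radical_of_fg`); `sᵏ` is a unit modulo `𝔪`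
  (`y·sᵏ + i = 1`, `i ∈ 𝔪`), and `x = y(sᵏx) + ix ∈ J + 𝔪ᵏ⁺¹` for `x ∈ 𝔪ᵏ`.  With the Nakayama direction of
  `PurelyInseparableDim4IsolationCert` (`le_of_pow_le_sup_pow_succ`): **`pow_le_sup_pow_succ_iff_minimalPrimes`**.
* §2 `originIdeal_isMaximal` (`𝔪₀ = ker (eval 0)` is maximal — the frame instance of §1 is then p-14's
  theorem) and **`certificate_mono`** (any commutative ring): a certificate at `N` is a certificate at every
  `M ≥ N`, so idea-3's `N⁺ = min {N : 𝔪₀ᴺ ≤ J_q⁺ + 𝔪₀ᴺ⁺¹}` is well defined on exactly the isolated states and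
  an «undecided at NMAX» verdict is monotone in NMAX.

[OURS · counted 0 · elementary commutative algebra; AI kernel work, weaker than expert review.]  Nothing here
is a statement about resolution of singularities; resolution in dimension `≥ 4` / characteristic `p > 0` is
NOT proved by anything in this file.  Host item (DR-157-C): `stmt-ResolutionOfSingularities-16155`, helper.
-/

noncomputable section

set_option linter.dupNamespace false -- mandated namespace of this single-conjunct summit

open MvPolynomial Finset
open scoped BigOperators

namespace Summit.ResolutionOfSingularities.ResolutionOfSingularities.Theorems.PIDim4.IsolationCert

/-! ## §1 Noetherian rings: isolated ⇒ certificate -/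

/-- **Isolated ⇒ certificate (Noetherian ring, maximal `𝔪`).** If `𝔪` is maximal and every minimal prime
of `J` contained in `𝔪` equals `𝔪`, then `𝔪ᴺ ≤ J + 𝔪ᴺ⁺¹` for some `N` (see the module docstring for the
four-line argument; no localisation is used; `J ≤ 𝔪` is not even needed). OURS (elementary).
[cite: AtiyahMacdonald1969, Prop. 7.14 / Cor. 7.16 (powers of the radical in Noetherian rings), Prop. 1.11 (prime avoidance)] -/
theorem exists_pow_le_sup_pow_succ_of_minimalPrimes {A : Type*} [CommRing A] [IsNoetherianRing A]
    {J m : Ideal A} (hm : m.IsMaximal)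
    (hmin : ∀ P ∈ J.minimalPrimes, P ≤ m → P = m) : ∃ N : ℕ, m ^ N ≤ J ⊔ m ^ (N + 1) := by
  classical
  have hfin := Ideal.finite_minimalPrimes_of_isNoetherianRing A J
  -- the minimal primes off `m` and their product
  set T : Finset (Ideal A) := hfin.toFinset.filter fun P => ¬ P ≤ m with hT
  have hQ : ¬ T.prod id ≤ m := by
    rw [hm.isPrime.prod_le]
    rintro ⟨P, hP, hPm⟩
    exact (Finset.mem_filter.mp hP).2 hPm
  obtain ⟨s, hsQ, hsm⟩ := Set.not_subset.mp hQ
  -- `s • m ≤ √J`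
  have hsP : ∀ P ∈ J.minimalPrimes, ¬ P ≤ m → s ∈ P := by
    intro P hP hPm
    have hPT : P ∈ T := Finset.mem_filter.mpr ⟨hfin.mem_toFinset.mpr hP, hPm⟩
    exact (Ideal.prod_le_inf.trans (Finset.inf_le hPT)) hsQ
  have hrad : Ideal.span {s} * m ≤ J.radical := by
    rw [← Ideal.sInf_minimalPrimes]
    refine le_sInf fun P hP => ?_
    rw [Ideal.mul_le]
    intro a ha x hx
    obtain ⟨c, rfl⟩ := Ideal.mem_span_singleton'.mp ha
    by_cases hPm : P ≤ m
    · rw [hmin P hP hPm]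
      exact m.mul_mem_left _ hx
    · exact P.mul_mem_right _ (P.mul_mem_left _ (hsP P hP hPm))
  obtain ⟨k, hk⟩ := Ideal.exists_pow_le_of_le_radical_of_fg hrad (IsNoetherian.noetherian _)
  -- `s^k • m^k ≤ J`
  have hsk : ∀ x ∈ m ^ k, s ^ k * x ∈ J := by
    intro x hx
    apply hk
    rw [mul_pow, Ideal.span_singleton_pow]
    exact Ideal.mul_mem_mul (Ideal.mem_span_singleton_self _) hx
  -- `s^k` is a unit modulo `m`
  have hskm : s ^ k ∉ m := fun h => hsm (hm.isPrime.mem_of_pow_mem k h)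
  obtain ⟨y, i, hi, hyi⟩ := hm.exists_inv hskm
  refine ⟨k, fun x hx => ?_⟩
  have hx' : x = y * (s ^ k * x) + i * x := by
    calc x = (y * s ^ k + i) * x := by rw [hyi, one_mul]
      _ = y * (s ^ k * x) + i * x := by ring
  rw [hx']
  refine Submodule.add_mem_sup (J.mul_mem_left _ (hsk x hx)) ?_
  rw [pow_succ']
  exact Ideal.mul_mem_mul hi hx

/-- **Certificate ⇔ isolation, ring form** (Noetherian `A`, `𝔪` maximal): `∃ N, 𝔪ᴺ ≤ J + 𝔪ᴺ⁺¹` iff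
every minimal prime of `J` inside `𝔪` is `𝔪`. OURS (elementary).
[cite: AtiyahMacdonald1969, Prop. 2.6 / Cor. 2.7 (Nakayama's lemma)] -/
theorem pow_le_sup_pow_succ_iff_minimalPrimes {A : Type*} [CommRing A] [IsNoetherianRing A]
    {J m : Ideal A} (hm : m.IsMaximal) :
    (∃ N : ℕ, m ^ N ≤ J ⊔ m ^ (N + 1)) ↔ ∀ P ∈ J.minimalPrimes, P ≤ m → P = m := by
  constructor
  · rintro ⟨N, hN⟩ P hP hPm
    exact le_antisymm hPm
      (le_of_pow_le_sup_pow_succ (IsNoetherian.noetherian _) hm.ne_top hN hP.1.1 hP.1.2 hPm)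
  · exact exists_pow_le_sup_pow_succ_of_minimalPrimes hm

/-! ## §2 The frame's `𝔪₀` is maximal; certificates are monotone in `N` -/

/-- `𝔪₀ = ker (eval 0)` is a maximal ideal of `K[x₁..x₄]` (`eval 0` is onto the field `K`); with §1 this is
the ring-form route to p-14's `IsolationConverse.exists_certificate_of_isIsolated` (cited, not restated).
OURS (bookkeeping).
[cite: AtiyahMacdonald1969, Ch. 1 Ex. 1.1 (the ideal (x₁,…,xₙ))] -/
theorem originIdeal_isMaximal (K : Type) [Field K] : (originIdeal K).IsMaximal := by
  unfold originIdeal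
  exact RingHom.ker_isMaximal_of_surjective (MvPolynomial.eval (0 : Fin 4 → K))
    fun a => ⟨C a, by simp⟩

/-- **Certificates are upward closed in `N`**: a certificate at `N` gives one at every `M ≥ N`
(`𝔪ᴹ ≤ 𝔪ᴺ ≤ J + 𝔪ᴺ⁺¹`, and iterating `𝔪ᴺ⁺¹ = 𝔪·𝔪ᴺ ≤ 𝔪·J + 𝔪ᴺ⁺² ≤ J + 𝔪ᴺ⁺²`); so `N⁺ = min` is
well defined and any `N ≥ N⁺` certifies. OURS (bookkeeping; any commutative ring).
[cite: AtiyahMacdonald1969, Ch. 1 (operations on ideals)] -/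
theorem certificate_mono {A : Type*} [CommRing A] {J m : Ideal A} {N : ℕ}
    (h : m ^ N ≤ J ⊔ m ^ (N + 1)) {M : ℕ} (hM : N ≤ M) : m ^ M ≤ J ⊔ m ^ (M + 1) := by
  -- first: `m^N ≤ J ⊔ m^(N + k)` for every `k ≥ 1`
  have step : ∀ k : ℕ, m ^ N ≤ J ⊔ m ^ (N + 1 + k) := by
    intro k
    induction k with
    | zero => simpa using h
    | succ k ih =>
      have h1 : m ^ (N + 1) ≤ J ⊔ m ^ (N + 1 + (k + 1)) := by
        calc m ^ (N + 1) = m * m ^ N := pow_succ' m N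
          _ ≤ m * (J ⊔ m ^ (N + 1 + k)) := Ideal.mul_mono_right ih
          _ = m * J ⊔ m * m ^ (N + 1 + k) := Ideal.mul_sup m J _
          _ ≤ J ⊔ m ^ (N + 1 + (k + 1)) := by
            refine sup_le_sup Ideal.mul_le_left ?_
            rw [show N + 1 + (k + 1) = (N + 1 + k) + 1 by ring, pow_succ' m (N + 1 + k)]
      exact h.trans (sup_le le_sup_left h1)
  obtain ⟨k, rfl⟩ := Nat.exists_eq_add_of_le hM
  calc m ^ (N + k) ≤ m ^ N := Ideal.pow_le_pow_right (Nat.le_add_right N k)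
    _ ≤ J ⊔ m ^ (N + 1 + k) := step k
    _ = J ⊔ m ^ (N + k + 1) := by rw [show N + 1 + k = N + k + 1 by ring]

end Summit.ResolutionOfSingularities.ResolutionOfSingularities.Theorems.PIDim4.IsolationCert

end
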